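import Summits.QuantumFields.BalabanUV.T4Continuum.Support.NE7PairwiseOffsetEndSeq
import Summits.QuantumFields.BalabanUV.T4Continuum.Support.NE7PairwiseDeepBadClass

/-!
# NE7PairwiseFibre — row NE7 (node U5), route «PAIR-CAUCHY» (R-P2, 1-bis): the finer run READ ON THE COARSER RUN'S
# LABELS by fibre sums (node U5d), and the consequence for the (E♭) socket — its whole BAD-CLASS SIDE (`hZB`, `hB`, `hWA`,
# `hWB`, `hW1`, `hWη`) is ONE-RUN data plus label design; the only two-run input left is the good clause

Cell `pub-balaban`, rung (B)+1 sub-cell t4, lineage `b2b-balaban-t4-ne7-p2` (CRUX PROVER NE7 #2 under the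
coordinator ruling «YM redirect», 2026-08-21; generation 55; texts: `HOME/t4/b2b-balaban-t4-ne7-p2/g55/ROUTE2-NE7-P2.md`
v1.10 §13, the crux refuter's `HOME/b2b-balaban-t4-ne7-refuter/PRICING-NE7.md` v10 §55 («`hWB` — the finer run's ONE
inequality uniform in K′ (a one-run size of the bad class read at levels ≤ K = rows NE7b ∕ NE7c's common-mode currency)»;
VERDICT: «(ii) (per-level suppression p summable in the level index, uniform over the finer runs — rows NE7b ∕ NE7c's
currency)»), and the headers of `Support/NE7PairwiseOffsetEndSeq` (p261256), `Support/NE7PairwiseOffsetEndWindow`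
(p259223 ∕ p261319), `Support/NE7PairwiseDeepBadClass` (p259975) and the Literature interface
`Balaban1983to89/T4HybridMatching` §3 (`fiberSum`, `sum_fiberSum`, `HybridSandwich.of_fibers` — node U5d «B's terms
carrying extra finest-scale data are summed inside each A-class»).  HONEST FRAMING (page 1): FIXED FINITE T⁴, rung (B)+1
= existence AND uniqueness of the `ε = L^{−K} → 0` limit of unit-scale averaged expectations, CONDITIONAL on BetaPertH
and the nine spine estimates (0/9 proved); NOT infinite volume, NOT a mass gap, NOT the Clay problem.  NE7 is NOT PRINTED
in [Balaban1984PropagatorsI]–[Balaban1989LargeFieldII] and NOT proved here.  Everything below is [folklore] finite-sum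
bookkeeping over HYPOTHESIS SHAPES (abstract finite families of reals); no definition, no cite tag, nothing printed
asserted, no `sorry`.

WHY.  In every (E♭) socket of this route (p255333, p259223, p261256) the finer run `K′` enters through an abstract family
`B K K′ t : ι → ℝ` on the COARSER run's labels `T K`, with its own list of hypotheses: `hZB` (it re-sums to `Z K′ t`),
`hB` (nonnegative), `hWB` («ONE inequality for the finer run, uniform in `K′`»: the `B`-weight of run `K`'s bad labels is
`≤ W w K · total`), next to run `K`'s own `hWA`, `hW1`, `hWη`.  PRICING-NE7 v10 §55 books `hWB` as a supplier ask «uniform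
over the finer runs».  But `B` is not free data: by node U5d it is the FIBRE SUM of run `K′`'s OWN terms along the label
projection `π K K′ : T K′ → T K` (forget the `K′ − K` extra ultraviolet levels of the history),
`B K K′ t τ = Σ_{τ′ ∈ T K′, π τ′ = τ} A K′ t τ′` (`T4HybridMatching.fiberSum`).  With this typing: `hZB` and `hB` are
IDENTITIES (`sum_fiberSum`, `fiberSum_nonneg`); and `hWB` FOLLOWS from run `K′`'s OWN one-run bad-class bound at the same
window (`Σ_{Bad w K′ t} A K′ t ≤ η w · Σ_{T K′} A K′ t`, the K-free level tail of p259975) plus ONE DESIGN FACT about the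
labels — COMPATIBILITY: a run-`K′` label whose projection carries a large-field ∕ boundary degree of freedom at an age
`≥ w` carries one itself (`π K K′ τ′ ∈ Bad w K t → τ′ ∈ Bad w K′ t`; the ages `≤ K` of `τ′` ARE those of `π τ′`).  So the
bad-class side of the socket is ONE-RUN (the per-level suppression of EACH run separately — rows NE7b ∕ NE7c's printed
TYPE, (1.62)-class — with a constant depending on the window only) + DESIGN (projections, compatibility); «uniform over
the finer runs» is not an extra clause: it is the finer run's own bound read through the fibre (§1
`badWeight_fiberSum_le`).  After this file the (E♭) socket's inputs are, exhaustively: one family of runs with labels,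
nonnegative terms and positive partition functions; label projections between runs (node U5d design); per-level one-run
large-field bounds `p j`, summable in the level (= age) index with `Σ p < 1`; compatibility of the level pieces under
projection; and — the ONLY two-run input — road P1's good clause for `(A K, fibre sum of A (K + ν K))` along every
offset sequence `ν` with a null remainder ((E♭-inst) (i), supplier ask, unchanged).

WHAT IS PROVED ([folklore]).
§1 `sum_fiberSum_eq` (`hZB` is an identity), `fiberSum_nonneg'` (`hB`), `sum_bad_fiberSum_eq` (the `B`-weight of a set
   of coarse labels = the `A′`-weight of its preimage), **`badWeight_fiberSum_le`** (`hWB` ⟸ the finer run's own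
   bad-class bound + compatibility).
§2 **`pairCauchy_of_oneRunBadClasses`** — the sequence-indexed K-only socket `NE7PairwiseOffsetEndSeq.pairCauchy_of_
   seqKOnlyBadClasses` with `B := fibre sums of A`, ALL bad-class hypotheses replaced by: `Bad w K t ⊆ T K`, ONE-RUN
   bound `Σ_{Bad w K t} A K t ≤ η w · Σ_{T K} A K t` for every run `K` (window-only constant), compatibility, `η w < 1`,
   `η → 0`; plus the per-sequence good clauses.  Conclusion: the `ε–K₀` pair-Cauchy statement.
§3 **`pairCauchy_of_levelPieces`** — §2 assembled with p259975: per-level pieces `LF K j t ⊆ T K` of each run with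
   one-run weights `≤ p j · Σ_{T K} A K t`, `0 ≤ p` summable, `Σ' p < 1`, pieces compatible under projection, bad class
   := the level union over `j ∈ [w, K]`; `η w := Σ'_j p (j + w)`.
§4 EXITS BY NAME: **`genFunCauchy_of_levelPieces`** (node U6 `T4Assembly.GenFunCauchy S l₀`),
   `hasContinuumLimit_of_levelPieces` (node U0).

NOT DELIVERED: the per-level one-run large-field bounds for Bałaban's runs (rows NE7b ∕ NE7c, printed TYPE (1.62) ∕
[Balaban1988LargeFieldI]–[Balaban1989LargeFieldII], NOT instantiated), the label projections and the compatibility of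
the large-field pieces for the TYPED histories (design, road P1's label typing `T4RecentScale` ∕ NODE W), the per-sequence
good clauses ((E♭-inst) (i)), NODE O (road P1's, inherited verbatim).  NOT NE7 (spine 0/9 unchanged), NOT summit progress.
HONEST DEPENDENCY: continuum YM on T⁴ ⇐ BetaPertH ∧ nine spine estimates (0/9 proved); BetaPertH ⇐ (D1) ∧ (D4) ∧
CAP+tail; G-an2-4 gates asym, D1 and NE2/3/4.
-/

noncomputable section

open Finset Filter Topology
open scoped BigOperators

namespace Summit.QuantumFields.BalabanUV.T4Continuum.NE7PairwiseFibre

open Literature.MathematicalPhysics.QuantumFieldTheory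
open Literature.MathematicalPhysics.QuantumFieldTheory.Balaban1983to89
open T4HybridMatching (fiberSum sum_fiberSum fiberSum_nonneg)
open T4GoodClassBudget (GoodClause)
open Summit.QuantumFields.BalabanUV.T4Continuum.NE7PairwiseCauchyWindow (cauchySeq_genFun_of_pairCauchy)
open Summit.QuantumFields.BalabanUV.T4Continuum.NE7PairwiseOffsetEndSeq (pairCauchy_of_seqKOnlyBadClasses)
open Summit.QuantumFields.BalabanUV.T4Continuum.NE7PairwiseDeepBadClass
  (levelUnion_weight_le_tail sum_Icc_le_tsum_of_nonneg tendsto_tsum_tail)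

/-! ## §1 Fibre sums: the finer run on the coarser run's labels -/

section Fibre

variable {ι : Type*} [DecidableEq ι]

/-- `hZB` IS AN IDENTITY: the fibre sums over the coarse labels re-sum to the finer run's own total
(`T4HybridMatching.sum_fiberSum`). [folklore] -/
theorem sum_fiberSum_eq {S Tc : Finset ι} {p : ι → ι} (hmaps : ∀ s ∈ S, p s ∈ Tc) (a' : ι → ℝ) :
    ∑ τ ∈ Tc, fiberSum S p a' τ = ∑ s ∈ S, a' s :=
  sum_fiberSum a' hmaps

/-- `hB`: fibre sums of nonnegative weights are nonnegative. [folklore] -/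
theorem fiberSum_nonneg' {S : Finset ι} {p : ι → ι} {a' : ι → ℝ} (ha' : ∀ s ∈ S, 0 ≤ a' s) (τ : ι) :
    0 ≤ fiberSum S p a' τ :=
  fiberSum_nonneg ha' τ

/-- THE `B`-WEIGHT OF A SET OF COARSE LABELS IS THE FINER RUN'S WEIGHT OF ITS PREIMAGE:
`Σ_{τ ∈ Bd} fiberSum S p a′ τ = Σ_{s ∈ S, p s ∈ Bd} a′ s`. [folklore] -/
theorem sum_bad_fiberSum_eq {S Bd : Finset ι} (p : ι → ι) (a' : ι → ℝ) :
    ∑ τ ∈ Bd, fiberSum S p a' τ = ∑ s ∈ S.filter (fun s => p s ∈ Bd), a' s := by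
  unfold fiberSum
  rw [← Finset.sum_fiberwise_of_maps_to (s := S.filter (fun s => p s ∈ Bd)) (t := Bd) (g := p)
    (fun s hs => (Finset.mem_filter.mp hs).2) a']
  refine Finset.sum_congr rfl fun τ hτ => Finset.sum_congr ?_ fun _ _ => rfl
  ext s
  simp only [Finset.mem_filter]
  constructor
  · rintro ⟨hs, hps⟩
    exact ⟨⟨hs, hps ▸ hτ⟩, hps⟩
  · rintro ⟨⟨hs, _⟩, hps⟩
    exact ⟨hs, hps⟩

/-- **`hWB` FROM THE FINER RUN'S OWN BOUND + COMPATIBILITY.**  Finer labels `S` projecting into the coarse labels `Tc`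
(`hmaps`), nonnegative finer weights `a′`, a coarse bad set `Bd` and a finer bad set `Bd′ ⊆ S` with the finer run's
ONE-RUN bound `Σ_{Bd′} a′ ≤ W′·Σ_S a′`, and COMPATIBILITY (`p s ∈ Bd → s ∈ Bd′`: a finer label whose projection is bad
is bad) ⟹ the fibre-summed weight of the coarse bad set is `≤ W′ ·` (fibre-summed total): exactly the socket's `hWB`,
with the FINER run's own constant. [folklore] -/
theorem badWeight_fiberSum_le {S Tc Bd Bd' : Finset ι} {p : ι → ι} {a' : ι → ℝ} {W' : ℝ}
    (hmaps : ∀ s ∈ S, p s ∈ Tc) (ha' : ∀ s ∈ S, 0 ≤ a' s) (hBd' : Bd' ⊆ S)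
    (hcompat : ∀ s ∈ S, p s ∈ Bd → s ∈ Bd') (hW' : ∑ s ∈ Bd', a' s ≤ W' * ∑ s ∈ S, a' s) :
    ∑ τ ∈ Bd, fiberSum S p a' τ ≤ W' * ∑ τ ∈ Tc, fiberSum S p a' τ := by
  rw [sum_bad_fiberSum_eq, sum_fiberSum_eq hmaps]
  refine le_trans ?_ hW'
  refine Finset.sum_le_sum_of_subset_of_nonneg (fun s hs => ?_) fun s hs _ => ha' s (hBd' hs)
  obtain ⟨hsS, hps⟩ := Finset.mem_filter.mp hs
  exact hcompat s hsS hps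

end Fibre

/-! ## §2 The one-run reduction of the socket's bad-class side -/

section OneRun

variable {ι : Type*} [DecidableEq ι] {l₀ vol : ℝ} {T : ℕ → Finset ι} {A : ℕ → ℝ → ι → ℝ} {Z : ℕ → ℝ → ℝ}

/-- **PAIR-CAUCHY FROM ONE-RUN BAD-CLASS DATA.**  ONE family of runs (labels `T K`, terms `A K t ≥ 0`, `Z K t = Σ A K t
> 0`); label projections `π K K′ : T K′ → T K` (node U5d); K-only windowed bad classes `Bad w K t ⊆ T K` with the ONE-RUN
bound `Σ_{Bad w K t} A K t ≤ η w · Σ_{T K} A K t` for EVERY run `K` (a constant depending on the window only — the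
level tail of `NE7PairwiseDeepBadClass`), COMPATIBLE under projection; `η w < 1`, `η → 0`; and — the only two-run input
— for every window `w` and every offset sequence `ν`, road P1's `GoodClause` for `(A K, fibre sum of A (K + ν K))` off
`Bad w K` with a remainder `δ w ν K → 0`.  THEN all pairs `K₀ ≤ K ≤ K′` match within any `ε > 0`.  The socket's `hZB`,
`hB`, `hWB`, `hW1`, `hWη` are DERIVED (§1), not assumed. [folklore] -/
theorem pairCauchy_of_oneRunBadClasses (π : ℕ → ℕ → ι → ι) {Bad : ℕ → ℕ → ℝ → Finset ι}
    {δ : ℕ → (ℕ → ℕ) → ℕ → ℝ} {η : ℕ → ℝ}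
    (hZA : ∀ (K : ℕ) (t : ℝ), |t| ≤ l₀ → Z K t = ∑ τ ∈ T K, A K t τ)
    (hpos : ∀ (K : ℕ) (t : ℝ), |t| ≤ l₀ → 0 < ∑ τ ∈ T K, A K t τ)
    (hA : ∀ K t, |t| ≤ l₀ → ∀ τ ∈ T K, 0 ≤ A K t τ)
    (hmaps : ∀ K K', K ≤ K' → ∀ τ' ∈ T K', π K K' τ' ∈ T K)
    (hbad : ∀ w K t, |t| ≤ l₀ → Bad w K t ⊆ T K)
    (hcompat : ∀ w K K' t, K ≤ K' → |t| ≤ l₀ → ∀ τ' ∈ T K', π K K' τ' ∈ Bad w K t → τ' ∈ Bad w K' t)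
    (hWone : ∀ w K t, |t| ≤ l₀ → ∑ τ ∈ Bad w K t, A K t τ ≤ η w * ∑ τ ∈ T K, A K t τ)
    (hη1 : ∀ w, η w < 1) (hη : Tendsto η atTop (𝓝 0))
    (hgood : ∀ w (ν : ℕ → ℕ), GoodClause l₀ vol T A
      (fun K t => fiberSum (T (K + ν K)) (π K (K + ν K)) (A (K + ν K) t)) (Bad w) (δ w ν))
    (hδ : ∀ w ν, Tendsto (δ w ν) atTop (𝓝 0)) :
    ∀ ε : ℝ, 0 < ε → ∃ K₀ : ℕ, ∀ K K' : ℕ, K₀ ≤ K → K ≤ K' →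
      ∃ c : ℝ, ∀ t : ℝ, |t| ≤ l₀ → |Real.log (Z K' t) - Real.log (Z K t) - c| ≤ ε :=
  pairCauchy_of_seqKOnlyBadClasses (B := fun K K' t => fiberSum (T K') (π K K') (A K' t)) (W := fun w _ => η w)
    hZA
    (fun K K' t hKK' ht => by rw [sum_fiberSum_eq (hmaps K K' hKK')]; exact hZA K' t ht)
    hpos (fun w _ => hη1 w) hA
    (fun K K' t _ ht τ _ => fiberSum_nonneg' (hA K' t ht) τ)
    hbad hWone
    (fun w K K' t hKK' ht => badWeight_fiberSum_le (hmaps K K' hKK') (hA K' t ht) (hbad w K' t ht)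
      (hcompat w K K' t hKK' ht) (hWone w K' t ht))
    hgood hδ (fun w => Eventually.of_forall fun _ => le_rfl) hη1 hη

end OneRun

/-! ## §3 Assembled with the level tails of `NE7PairwiseDeepBadClass`: per-level pieces of each run -/

section LevelPieces

variable {ι : Type*} [DecidableEq ι] {l₀ vol : ℝ} {T : ℕ → Finset ι} {A : ℕ → ℝ → ι → ℝ} {Z : ℕ → ℝ → ℝ}

/-- A tail of a nonnegative summable sequence is at most the whole sum. [folklore] -/
theorem tsum_tail_le_tsum {p : ℕ → ℝ} (hp0 : ∀ j, 0 ≤ p j) (hp : Summable p) (w : ℕ) :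
    ∑' j, p (j + w) ≤ ∑' j, p j := by
  rw [← hp.sum_add_tsum_nat_add w]
  exact le_add_of_nonneg_left (Finset.sum_nonneg fun j _ => hp0 j)

/-- COMPATIBILITY OF LEVEL PIECES ⟹ COMPATIBILITY OF THEIR WINDOWED UNIONS. [folklore] -/
theorem compat_biUnion {LF : ℕ → ℕ → ℝ → Finset ι} {π : ℕ → ℕ → ι → ι} {K K' : ℕ} (hKK' : K ≤ K') {t : ℝ}
    (hcompat : ∀ j, j ≤ K → ∀ τ', π K K' τ' ∈ LF K j t → τ' ∈ LF K' j t) (w : ℕ) (τ' : ι)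
    (h : π K K' τ' ∈ (Finset.Icc w K).biUnion (fun j => LF K j t)) :
    τ' ∈ (Finset.Icc w K').biUnion (fun j => LF K' j t) := by
  obtain ⟨j, hj, hjτ⟩ := Finset.mem_biUnion.mp h
  have hj' := Finset.mem_Icc.mp hj
  exact Finset.mem_biUnion.mpr ⟨j, Finset.mem_Icc.mpr ⟨hj'.1, hj'.2.trans hKK'⟩, hcompat j hj'.2 τ' hjτ⟩

/-- **PAIR-CAUCHY FROM PER-LEVEL ONE-RUN PIECES.**  For each run `K`, level (= age) `j` and source `t` a large-field ∕
boundary piece `LF K j t ⊆ T K` with the ONE-RUN weight bound `Σ_{LF K j t} A K t ≤ p j · Σ_{T K} A K t`, `0 ≤ p`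
summable in the level index with `Σ' p < 1` (rows NE7b ∕ NE7c's printed TYPE, one run at a time, the SAME `p` for every
run — UV-uniformity); pieces compatible under the label projections (`π K K′ τ′ ∈ LF K j t → τ′ ∈ LF K′ j t`, `j ≤ K ≤
K′`); terms nonnegative; and the per-sequence good clauses off the level union `⋃_{j ∈ [w,K]} LF K j t`.  THEN pair-Cauchy
— with `η w := Σ'_j p (j + w)` supplied by `NE7PairwiseDeepBadClass.levelUnion_weight_le_tail`. [folklore] -/
theorem pairCauchy_of_levelPieces (π : ℕ → ℕ → ι → ι) {LF : ℕ → ℕ → ℝ → Finset ι} {p : ℕ → ℝ}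
    {δ : ℕ → (ℕ → ℕ) → ℕ → ℝ}
    (hZA : ∀ (K : ℕ) (t : ℝ), |t| ≤ l₀ → Z K t = ∑ τ ∈ T K, A K t τ)
    (hpos : ∀ (K : ℕ) (t : ℝ), |t| ≤ l₀ → 0 < ∑ τ ∈ T K, A K t τ)
    (hA0 : ∀ K t, |t| ≤ l₀ → ∀ τ, 0 ≤ A K t τ)
    (hmaps : ∀ K K', K ≤ K' → ∀ τ' ∈ T K', π K K' τ' ∈ T K)
    (hLF : ∀ K j t, |t| ≤ l₀ → LF K j t ⊆ T K)
    (hcompat : ∀ K K' t, K ≤ K' → |t| ≤ l₀ → ∀ j, j ≤ K → ∀ τ', π K K' τ' ∈ LF K j t → τ' ∈ LF K' j t)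
    (hp0 : ∀ j, 0 ≤ p j) (hp : Summable p) (hp1 : ∑' j, p j < 1)
    (hpLF : ∀ K j t, |t| ≤ l₀ → ∑ τ ∈ LF K j t, A K t τ ≤ p j * ∑ τ ∈ T K, A K t τ)
    (hgood : ∀ w (ν : ℕ → ℕ), GoodClause l₀ vol T A
      (fun K t => fiberSum (T (K + ν K)) (π K (K + ν K)) (A (K + ν K) t))
      (fun K t => (Finset.Icc w K).biUnion (fun j => LF K j t)) (δ w ν))
    (hδ : ∀ w ν, Tendsto (δ w ν) atTop (𝓝 0)) :
    ∀ ε : ℝ, 0 < ε → ∃ K₀ : ℕ, ∀ K K' : ℕ, K₀ ≤ K → K ≤ K' →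
      ∃ c : ℝ, ∀ t : ℝ, |t| ≤ l₀ → |Real.log (Z K' t) - Real.log (Z K t) - c| ≤ ε := by
  refine pairCauchy_of_oneRunBadClasses π (Bad := fun w K t => (Finset.Icc w K).biUnion (fun j => LF K j t))
    (η := fun w => ∑' j, p (j + w)) hZA hpos (fun K t ht τ _ => hA0 K t ht τ) hmaps ?_ ?_ ?_ ?_ tendsto_tsum_tail
    hgood hδ
  · -- the level union sits inside the labels
    intro w K t ht
    exact Finset.biUnion_subset.mpr fun j _ => hLF K j t ht
  · -- compatibility of the unions
    intro w K K' t hKK' ht τ' _ h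
    exact compat_biUnion hKK' (hcompat K K' t hKK' ht) w τ' h
  · -- the one-run bound: a level tail, uniformly in K
    intro w K t ht
    exact levelUnion_weight_le_tail (fun j => LF K j t) (hA0 K t ht) hp0 hp (hpos K t ht).le
      (fun j => hpLF K j t ht) w K
  · -- η w < 1
    intro w
    exact lt_of_le_of_lt (tsum_tail_le_tsum hp0 hp w) hp1

end LevelPieces

/-! ## §4 Exits by name: node U6 and node U0 from per-level one-run pieces -/

section Exit

open Missing T4Continuum T4Assembly

variable {G : Type*} [GaugeGroup G] [MeasurableSpace G] [HaarData G] {O : Type*}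

/-- **NODE U6 FROM PER-LEVEL ONE-RUN PIECES + PER-SEQUENCE GOOD CLAUSES.**  Per string `os`: ONE family of runs on
labels `T K` with nonnegative terms and positive partition functions, label projections, per-level large-field pieces with
one-run weights `≤ p j·total` (`0 ≤ p` summable, `Σ' p < 1`) compatible under projection, and road P1's good clause for
`(A K, fibre sum of A (K + ν K))` off the level union at every window and along every offset sequence with a null
remainder ⟹ `GenFunCauchy S l₀`. [folklore] -/
theorem genFunCauchy_of_levelPieces {ι : Type*} [DecidableEq ι] (S : TorusScheme G O) {l₀ : ℝ} (hl₀ : 0 ≤ l₀)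
    (h : ∀ os : List O, ∃ (vol : ℝ) (T : ℕ → Finset ι) (A : ℕ → ℝ → ι → ℝ) (π : ℕ → ℕ → ι → ι)
      (LF : ℕ → ℕ → ℝ → Finset ι) (p : ℕ → ℝ) (δ : ℕ → (ℕ → ℕ) → ℕ → ℝ),
      (∀ (K : ℕ) (t : ℝ), |t| ≤ l₀ → T4GenFunBounds.schemeZ S os K t = ∑ τ ∈ T K, A K t τ) ∧
      (∀ (K : ℕ) (t : ℝ), |t| ≤ l₀ → 0 < ∑ τ ∈ T K, A K t τ) ∧
      (∀ K t, |t| ≤ l₀ → ∀ τ, 0 ≤ A K t τ) ∧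
      (∀ K K', K ≤ K' → ∀ τ' ∈ T K', π K K' τ' ∈ T K) ∧
      (∀ K j t, |t| ≤ l₀ → LF K j t ⊆ T K) ∧
      (∀ K K' t, K ≤ K' → |t| ≤ l₀ → ∀ j, j ≤ K → ∀ τ', π K K' τ' ∈ LF K j t → τ' ∈ LF K' j t) ∧
      (∀ j, 0 ≤ p j) ∧ Summable p ∧ ∑' j, p j < 1 ∧
      (∀ K j t, |t| ≤ l₀ → ∑ τ ∈ LF K j t, A K t τ ≤ p j * ∑ τ ∈ T K, A K t τ) ∧
      (∀ w (ν : ℕ → ℕ), GoodClause l₀ vol T A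
        (fun K t => fiberSum (T (K + ν K)) (π K (K + ν K)) (A (K + ν K) t))
        (fun K t => (Finset.Icc w K).biUnion (fun j => LF K j t)) (δ w ν)) ∧
      (∀ w ν, Tendsto (δ w ν) atTop (𝓝 0))) :
    GenFunCauchy S l₀ := by
  intro os t ht
  obtain ⟨vol, T, A, π, LF, p, δ, hZA, hpos, hA0, hmaps, hLF, hcompat, hp0, hp, hp1, hpLF, hgood, hδ⟩ := h os
  exact cauchySeq_genFun_of_pairCauchy hl₀
    (pairCauchy_of_levelPieces π hZA hpos hA0 hmaps hLF hcompat hp0 hp hp1 hpLF hgood hδ) ht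

/-- … and NODE U0 (`Missing.HasContinuumLimit S`) by `T4Assembly.hasContinuumLimit_of_genFunCauchy`. [folklore] -/
theorem hasContinuumLimit_of_levelPieces [RegularGaugeGroup G] {ι : Type*} [DecidableEq ι]
    (S : TorusScheme G O) (hβ : ∀ K, 0 ≤ S.β K) (hm : ∀ K o, Measurable (S.obs K o))
    (h1 : ∀ K o U, |S.obs K o U| ≤ 1) {l₀ : ℝ} (hl₀ : 0 < l₀)
    (h : ∀ os : List O, ∃ (vol : ℝ) (T : ℕ → Finset ι) (A : ℕ → ℝ → ι → ℝ) (π : ℕ → ℕ → ι → ι)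
      (LF : ℕ → ℕ → ℝ → Finset ι) (p : ℕ → ℝ) (δ : ℕ → (ℕ → ℕ) → ℕ → ℝ),
      (∀ (K : ℕ) (t : ℝ), |t| ≤ l₀ → T4GenFunBounds.schemeZ S os K t = ∑ τ ∈ T K, A K t τ) ∧
      (∀ (K : ℕ) (t : ℝ), |t| ≤ l₀ → 0 < ∑ τ ∈ T K, A K t τ) ∧
      (∀ K t, |t| ≤ l₀ → ∀ τ, 0 ≤ A K t τ) ∧
      (∀ K K', K ≤ K' → ∀ τ' ∈ T K', π K K' τ' ∈ T K) ∧
      (∀ K j t, |t| ≤ l₀ → LF K j t ⊆ T K) ∧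
      (∀ K K' t, K ≤ K' → |t| ≤ l₀ → ∀ j, j ≤ K → ∀ τ', π K K' τ' ∈ LF K j t → τ' ∈ LF K' j t) ∧
      (∀ j, 0 ≤ p j) ∧ Summable p ∧ ∑' j, p j < 1 ∧
      (∀ K j t, |t| ≤ l₀ → ∑ τ ∈ LF K j t, A K t τ ≤ p j * ∑ τ ∈ T K, A K t τ) ∧
      (∀ w (ν : ℕ → ℕ), GoodClause l₀ vol T A
        (fun K t => fiberSum (T (K + ν K)) (π K (K + ν K)) (A (K + ν K) t))
        (fun K t => (Finset.Icc w K).biUnion (fun j => LF K j t)) (δ w ν)) ∧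
      (∀ w ν, Tendsto (δ w ν) atTop (𝓝 0))) :
    Missing.HasContinuumLimit S :=
  hasContinuumLimit_of_genFunCauchy S hβ hm h1 hl₀ (genFunCauchy_of_levelPieces S hl₀.le h)

end Exit

end Summit.QuantumFields.BalabanUV.T4Continuum.NE7PairwiseFibre

end
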